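import Summits.ResolutionOfSingularities.ResolutionOfSingularities.Theorems.WeightedInvariantELadderTwoReadChart
import Summits.ResolutionOfSingularities.ResolutionOfSingularities.Theorems.WeightedInvariantE2HomogeneousChartDefs
import Summits.ResolutionOfSingularities.ResolutionOfSingularities.Theorems.WeightedInvariantE2HomogeneousShrink
import Summits.ResolutionOfSingularities.ResolutionOfSingularities.Theorems.WeightedInvariantHypersurfaceCentreAssemblyPointDict
import Literature.AlgebraicGeometry.Resolution.CotangentIndependenceSpread
import HarnessLib

/-!
# E-ladder rung `e = 2`, centre piece (C-c), scheme hand (o47-c-scheme): THE MODEL CHART AT A POINT OF THE MAXIMUM LOCUS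

[OURS · L1 W4.3 · DOOR `HypersurfaceCentreConstruction` (stmt-ResolutionOfSingularities-19897) · E2 CENTRE piece (C-c), step (G-1) of the
registrar's DESIGN MEMO `E2-CENTRE-GLUE-DESIGN-v0.md` / SPEC (Δ11b) rev 10; written by res-D-pv-048 (gen 11).  Def-free; `--supports` the door
item as a helper.  OURS bookkeeping, NOT a statement of [Hironaka2017]; AI work, weaker than expert review.]

Input: the graded HOM rung `PRungGrHomLE 3 p ι J` (for (c6) `IotaIsoInvariant`, `JIsoInvariant`, (c12a) `IotaUnitInvariant`, `JUnitInvariant`),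
the homogeneous chart body (G-0) `E2HomogeneousChartBody p ι J` (res-L1-s36-pv-1's `…E2HomogeneousChartDefs`), a stage `S`, a point
`η ∈ maxLocus₂ ι` and a UNIT chart `W a ∋ η`.  Output (`Stage.exists_e2ModelChartAt`): a HOMOGENEOUS section `t ∉ 𝔭_a(η)` and homogeneous
parameters `U : Fin N → Γ(Y, W a)` (`N ≤ 3`) with positive weights `w` such that on `D(t)`, at every point `y` with `dim 𝒪_{Y,y} ≤ 3`:
(S6) «all `U i` vanish at `y`» iff «`y ∈ singImage` and `ι_y = mu₂`»; (S5) if they vanish, `J(𝒪_{Y,y}, f_y)ₘ = 𝒥ₘ(U, w)·𝒪_{Y,y}` for all `m`;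
and (S3) at every common zero `y ∈ D(t)` of the `U i` their germs are cotangent-independent in `𝒪_{Y,y}` — i.e. exactly the per-chart
hypotheses (J), (Zʼ), (reg) of F2b `Stage.exists_isCanonicalCentre₂_of_modelCharts` (…ELadderTwoCentreLocalModels), read through the
model ↔ stalk dictionary (…CentreAssemblyStalkDict / …PointDict).

Mechanism: `A = Γ(Y, W a)` graded by the chart, `𝔪 = 𝔭_a(η)` (homogeneous, graded-simple quotient: `η` is orbit-generic), `F` a homogeneous
local generator of `𝓘(X)(W a)` at `η` with homogeneous denominator `g'` (031's `exists_homogeneous_localGenerator`); `A_𝔪 ≅ 𝒪_{Y,η}` is regular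
of dimension `≤ 3`, `F/1 ≠ 0`, `F/1 ∈ 𝔪²` (`η ∈ singImage`); (G-0) gives `h`, `U`, `w` and the clauses of `JOpenBodyLE3Hom`; the section is
`t := h · g' · h₀` with `h₀` a HOMOGENEOUS element off `𝔪` such that `F/1 ≠ 0` in `A_𝔮` for every prime `𝔮 ∌ h₀` (PointDict's
`exists_not_mem_forall_algebraMap_ne_zero` made homogeneous by s36-pv-1's shrink `exists_decompose_not_mem_forall_mem`, the failure set
`{𝔮 | ∃ s ∉ 𝔮, s F = 0}` being stable under homogeneous cores).
-/

noncomputable section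

set_option linter.dupNamespace false
set_option backward.isDefEq.respectTransparency false

open CategoryTheory AlgebraicGeometry TopologicalSpace IsLocalRing
open Literature.AlgebraicGeometry.Resolution
open Summit.ResolutionOfSingularities.ResolutionOfSingularities.Theorems
open Summit.ResolutionOfSingularities.ResolutionOfSingularities.Cruxes.HypersurfaceCentreConstruction.LocalEngine

namespace Summit.ResolutionOfSingularities.ResolutionOfSingularities.Theorems.ELadderOne.Stage

variable {k : Type} [Field k] (S : Stage k) {p : ℕ} (ι : (R : Type) → [CommRing R] → R → Ordinal.{0})
  (J : (R : Type) → [CommRing R] → R → ℕ → Ideal R)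

/-! ## The dictionary at a point where a section generates the hypersurface stalk -/

/-- Every stalk of the (smooth) ambient scheme of a stage is a regular local ring. [folklore] -/
theorem isRegularLocalRing_stalk (y : S.Y) : IsRegularLocalRing (S.Y.presheaf.stalk y) :=
  haveI : IsLocallyNoetherian S.Y := LocallyOfFiniteType.isLocallyNoetherian S.f
  Scheme.IsRegular.of_smooth S.f (Scheme.isRegular_Spec (.of k)) y

/-- **Local generator on `D(g')`.**  If `F ∈ 𝓘(X)(W)` and `g' · 𝓘(X)(W) ⊆ (F)`, then at every point of `W` off `V(g')` the germ of
`F` generates the hypersurface stalk ideal. [folklore] -/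
theorem stalkIdeal_eq_span_germ_of_not_mem (W : S.Y.affineOpens) {F g' : Γ(S.Y, W)} (hFI : F ∈ S.i.ker.ideal W)
    (hg' : ∀ x ∈ S.i.ker.ideal W, g' * x ∈ Ideal.span {F}) {y : S.Y} (hy : y ∈ (W : S.Y.Opens))
    (hg'y : g' ∉ (W.2.primeIdealOf ⟨y, hy⟩).asIdeal) :
    stalkIdeal S.i.ker y = Ideal.span {(S.Y.presheaf.germ (W : S.Y.Opens) y hy).hom F} := by
  rw [stalkIdeal_eq_map_germ S.i.ker W hy]
  apply le_antisymm
  · refine Ideal.map_le_iff_le_comap.mpr fun x hx => ?_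
    rw [Ideal.mem_comap]
    have hunit : IsUnit ((S.Y.presheaf.germ (W : S.Y.Opens) y hy).hom g') := by
      have h := (mem_basicOpen_iff_not_mem W hy g').mpr hg'y
      exact (S.Y.mem_basicOpen g' y hy).mp h
    have hmem : (S.Y.presheaf.germ (W : S.Y.Opens) y hy).hom g' * (S.Y.presheaf.germ (W : S.Y.Opens) y hy).hom x ∈
        Ideal.span {(S.Y.presheaf.germ (W : S.Y.Opens) y hy).hom F} := by
      rw [← map_mul]
      have h1 := Ideal.mem_map_of_mem (S.Y.presheaf.germ (W : S.Y.Opens) y hy).hom (hg' x hx)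
      rwa [Ideal.map_span, Set.image_singleton] at h1
    exact (Ideal.unit_mul_mem_iff_mem _ hunit).mp hmem
  · rw [Ideal.span_le, Set.singleton_subset_iff]
    exact Ideal.mem_map_of_mem _ hFI

variable {S ι J} in
/-- **`ι` read on the localised model** at a point where the germ of `F` generates the hypersurface stalk ideal ((c6) + (c12a)).
[folklore] -/
theorem iotaAt_eq_iota_of_span (hc6 : IotaIsoInvariant ι) (hu : IotaUnitInvariant ι) (W : S.Y.affineOpens) {y : S.Y}
    (hy : y ∈ (W : S.Y.Opens)) {F : Γ(S.Y, W)}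
    (hspan : stalkIdeal S.i.ker y = Ideal.span {(S.Y.presheaf.germ (W : S.Y.Opens) y hy).hom F}) :
    iotaAt ι S.i.ker y = ι (Localization.AtPrime (W.2.primeIdealOf ⟨y, hy⟩).asIdeal)
      (algebraMap Γ(S.Y, W) (Localization.AtPrime (W.2.primeIdealOf ⟨y, hy⟩).asIdeal) F) := by
  haveI : IsRegularLocalRing (S.Y.presheaf.stalk y) := S.isRegularLocalRing_stalk y
  haveI : IsDomain (S.Y.presheaf.stalk y) := isDomain_of_isRegularLocalRing (S.Y.presheaf.stalk y)
  have hgen : Ideal.span {localGenerator S.i.ker y} = Ideal.span {(S.Y.presheaf.germ (W : S.Y.Opens) y hy).hom F} := by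
    rw [← stalkIdeal_eq_span_localGenerator S.i.ker y ⟨_, hspan⟩, hspan]
  unfold iotaAt
  rw [_root_.Summit.ResolutionOfSingularities.ResolutionOfSingularities.Cruxes.HypersurfaceCentreConstruction.LocalEngine.iota_eq_of_span_singleton_eq
    ι hu hgen, ← stalkEquiv_algebraMap W hy F]
  exact hc6 _ _ (stalkEquiv W hy) _

variable {S ι J} in
/-- **`J` read on the localised model** at such a point: a presentation `J(A_𝔮, F/1)ₘ = I·A_𝔮` becomes `J(𝒪_{Y,y}, f_y)ₘ = I·𝒪_{Y,y}`
((c6) `JIsoInvariant` + (c12a) `JUnitInvariant`). [folklore] -/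
theorem J_localGenerator_eq_map_germ_of_span (hJ : JIsoInvariant J) (hJu : JUnitInvariant J) (W : S.Y.affineOpens) {y : S.Y}
    (hy : y ∈ (W : S.Y.Opens)) {F : Γ(S.Y, W)}
    (hspan : stalkIdeal S.i.ker y = Ideal.span {(S.Y.presheaf.germ (W : S.Y.Opens) y hy).hom F}) {m : ℕ}
    {I : Ideal Γ(S.Y, W)}
    (hpres : J (Localization.AtPrime (W.2.primeIdealOf ⟨y, hy⟩).asIdeal)
        (algebraMap Γ(S.Y, W) (Localization.AtPrime (W.2.primeIdealOf ⟨y, hy⟩).asIdeal) F) m =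
      I.map (algebraMap Γ(S.Y, W) (Localization.AtPrime (W.2.primeIdealOf ⟨y, hy⟩).asIdeal))) :
    J (S.Y.presheaf.stalk y) (localGenerator S.i.ker y) m = I.map (S.Y.presheaf.germ (W : S.Y.Opens) y hy).hom := by
  haveI : IsRegularLocalRing (S.Y.presheaf.stalk y) := S.isRegularLocalRing_stalk y
  haveI : IsDomain (S.Y.presheaf.stalk y) := isDomain_of_isRegularLocalRing (S.Y.presheaf.stalk y)
  have hgen : Ideal.span {localGenerator S.i.ker y} = Ideal.span {(S.Y.presheaf.germ (W : S.Y.Opens) y hy).hom F} := by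
    rw [← stalkIdeal_eq_span_localGenerator S.i.ker y ⟨_, hspan⟩, hspan]
  rw [_root_.Summit.ResolutionOfSingularities.ResolutionOfSingularities.Cruxes.HypersurfaceCentreConstruction.LocalEngine.J_eq_of_span_singleton_eq
    J hJu hgen m, ← stalkEquiv_algebraMap W hy F, hJ _ _ (stalkEquiv W hy) _ m, hpres]
  exact map_stalkEquiv_map W hy I

/-- Cotangent-independence is insensitive to rewriting the family pointwise. [folklore] -/
theorem linearIndependent_toCotangent_congr {R : Type*} [CommRing R] [IsLocalRing R] {n : ℕ} {x x' : Fin n → R}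
    (hx : ∀ i, x i ∈ maximalIdeal R) (hx' : ∀ i, x' i ∈ maximalIdeal R) (h : ∀ i, x i = x' i)
    (hli : LinearIndependent (ResidueField R) fun i => (maximalIdeal R).toCotangent ⟨x i, hx i⟩) :
    LinearIndependent (ResidueField R) fun i => (maximalIdeal R).toCotangent ⟨x' i, hx' i⟩ := by
  have e : (fun i => (maximalIdeal R).toCotangent ⟨x i, hx i⟩) = fun i => (maximalIdeal R).toCotangent ⟨x' i, hx' i⟩ :=
    funext fun i => congrArg _ (Subtype.ext (h i))
  rw [← e]
  exact hli

/-! ## The model chart at a point of the maximum locus -/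

/-- **THE MODEL CHART AT A POINT OF THE MAXIMUM LOCUS** (see the module docstring).  Conclusions, for the unit chart `W a ∋ η`:
a homogeneous section `t ∉ 𝔭_a(η)`, `N ≤ 3` homogeneous parameters `U i` with positive weights `w i`, and on `D(t)`:
(S5) at `y` with `dim 𝒪_{Y,y} ≤ 3`, if all `U i` vanish at `y` then `J(𝒪_{Y,y}, f_y)ₘ = 𝒥ₘ(U, w)·𝒪_{Y,y}`;
(S6) at `y` with `dim 𝒪_{Y,y} ≤ 3`: all `U i` vanish at `y` iff `y ∈ singImage` and `ι_y = mu₂`;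
(S3) at every common zero `y` of the `U i`, their germs are cotangent-independent in `𝒪_{Y,y}`. [folklore] -/
theorem exists_e2ModelChartAt [CharP k p] [PerfectField k] (hr : PRungGrHomLE 3 p ι J) (hG0 : E2HomogeneousChartBody p ι J)
    {η : S.Y} (hη : η ∈ S.maxLocus₂ ι) {a : S.atlas.ι} (ha : S.IsUnitChart a) (hηa : η ∈ (S.atlas.W a : S.Y.Opens)) :
    letI := S.atlas.gradedRing a
    ∃ (δ : Fin S.j → ℤ) (t : Γ(S.Y, S.atlas.W a)) (N : ℕ) (U : Fin N → Γ(S.Y, S.atlas.W a)) (w : Fin N → ℕ),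
      t ∈ S.atlas.piece a δ ∧ t ∉ ((S.atlas.W a).2.primeIdealOf ⟨η, hηa⟩).asIdeal ∧ N ≤ 3 ∧ (∀ i, 0 < w i) ∧
      (∀ i, SetLike.IsHomogeneousElem (S.atlas.piece a) (U i)) ∧
      (∀ (y : S.Y) (hy : y ∈ S.Y.basicOpen t), ringKrullDim (S.Y.presheaf.stalk y) ≤ ((3 : ℕ) : WithBot ℕ∞) →
        (∀ i, (S.Y.presheaf.germ (S.atlas.W a) y (S.Y.basicOpen_le t hy)).hom (U i) ∈ maximalIdeal (S.Y.presheaf.stalk y)) →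
        ∀ m : ℕ, J (S.Y.presheaf.stalk y) (localGenerator S.i.ker y) m =
          (weightedMonomialIdeal U w m).map (S.Y.presheaf.germ (S.atlas.W a) y (S.Y.basicOpen_le t hy)).hom) ∧
      (∀ (y : S.Y) (hy : y ∈ S.Y.basicOpen t), ringKrullDim (S.Y.presheaf.stalk y) ≤ ((3 : ℕ) : WithBot ℕ∞) →
        ((∀ i, (S.Y.presheaf.germ (S.atlas.W a) y (S.Y.basicOpen_le t hy)).hom (U i) ∈ maximalIdeal (S.Y.presheaf.stalk y)) ↔
          (y ∈ singImage S.i.ker ∧ iotaAt ι S.i.ker y = S.mu₂ ι))) ∧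
      (∀ (y : S.Y) (hy : y ∈ S.Y.basicOpen t)
        (hU : ∀ i, (S.Y.presheaf.germ (S.atlas.W a) y (S.Y.basicOpen_le t hy)).hom (U i) ∈ maximalIdeal (S.Y.presheaf.stalk y)),
        LinearIndependent (ResidueField (S.Y.presheaf.stalk y))
          (fun i => (maximalIdeal (S.Y.presheaf.stalk y)).toCotangent ⟨_, hU i⟩)) := by
  classical
  letI := S.atlas.gradedRing a
  obtain ⟨hc6, -, -, -, hJiso, -, -, -, hu, hJu⟩ := hr.1
  haveI := S.isNoetherianRing_sections (S.atlas.W a)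
  -- notation
  set A := Γ(S.Y, S.atlas.W a) with hA
  set 𝔪 : Ideal A := ((S.atlas.W a).2.primeIdealOf ⟨η, hηa⟩).asIdeal with h𝔪
  haveI h𝔪p : 𝔪.IsPrime := ((S.atlas.W a).2.primeIdealOf ⟨η, hηa⟩).2
  -- `η`: orbit-generic, in `singImage`, `dim ≤ 3`, `ι = mu₂`
  obtain ⟨⟨hηsing, hog, hdimη⟩, hιη⟩ := hη
  obtain ⟨hhom, hgs⟩ := hog a ha hηa
  haveI hregη : IsRegularLocalRing (S.Y.presheaf.stalk η) := S.isRegularLocalRing_stalk η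
  -- the homogeneous local generator `F` with homogeneous denominator `g'`
  obtain ⟨F, g', hFh, hFI, ⟨dg', hg'⟩, hg'𝔪, hg'F⟩ := S.exists_homogeneous_localGenerator a hηa
  have hspanη : stalkIdeal S.i.ker η = Ideal.span {(S.Y.presheaf.germ (S.atlas.W a) η hηa).hom F} :=
    S.stalkIdeal_eq_span_germ_of_not_mem (S.atlas.W a) hFI hg'F hηa hg'𝔪
  -- the model `A_𝔪 ≅ 𝒪_{Y,η}`: regular, `dim ≤ 3`, `F/1 ≠ 0`, `F/1 ∈ 𝔪²`
  haveI hreg𝔪 : IsRegularLocalRing (Localization.AtPrime 𝔪) := IsRegularLocalRing.of_ringEquiv (stalkEquiv (S.atlas.W a) hηa).symm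
  have hdim𝔪 : ringKrullDim (Localization.AtPrime 𝔪) ≤ (3 : ℕ) := by
    rw [ringKrullDim_eq_of_ringEquiv (stalkEquiv (S.atlas.W a) hηa)]
    exact hdimη
  have hgermF0 : (S.Y.presheaf.germ (S.atlas.W a) η hηa).hom F ≠ 0 :=
    ne_zero_of_mem_singImage_of_stalkIdeal_eq S.i.ker hspanη hηsing
  have hF0 : algebraMap A (Localization.AtPrime 𝔪) F ≠ 0 := fun h =>
    hgermF0 ((algebraMap_eq_zero_iff_germ_eq_zero (S.atlas.W a) hηa F).mp h)
  have hF2 : algebraMap A (Localization.AtPrime 𝔪) F ∈ maximalIdeal (Localization.AtPrime 𝔪) ^ 2 := by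
    rw [algebraMap_mem_maximalIdeal_pow_iff_germ_mem (S.atlas.W a) hηa F 2]
    exact (mem_singImage_iff_mem_sq_of_stalkIdeal_eq S.i.ker hspanη hgermF0).mp hηsing
  -- (G-0): the homogeneous chart body at `𝔪`
  have hbody : JOpenBodyLE3Hom (S.atlas.piece a) ι J 𝔪 F := by
    letI : Algebra k A := sectionsAlgebra S.kStr (S.atlas.W a)
    haveI : Algebra.FiniteType k A := S.finiteType_sections (S.atlas.W a)
    exact hG0 k A S.j (S.atlas.piece a) (fun c => S.algebraMap_mem_piece_zero a c) 𝔪 F hhom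
      (fun d x hx hx𝔪 => hgs d x hx hx𝔪) hFh hreg𝔪 hdim𝔪 hF0 hF2
  obtain ⟨h, hh𝔪, ⟨dh, hhdeg⟩, N, U, w, hw, hUhom, ⟨hU𝔪, hli𝔪⟩, hregq, hcl⟩ := hbody
  -- `ι(A_𝔪, F/1) = mu₂`
  have hι𝔪 : ι (Localization.AtPrime 𝔪) (algebraMap A (Localization.AtPrime 𝔪) F) = S.mu₂ ι := by
    rw [← iotaAt_eq_iota_of_span hc6 hu (S.atlas.W a) hηa hspanη]
    exact hιη
  -- `N ≤ 3`: `N` cotangent-independent vectors in the cotangent space of the regular `A_𝔪` of dimension `≤ 3`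
  have hN : N ≤ 3 := by
    have h1 := hli𝔪.fintype_card_le_finrank
    rw [Fintype.card_fin] at h1
    have h2 := (IsRegularLocalRing.iff_finrank_cotangentSpace (Localization.AtPrime 𝔪)).mp hreg𝔪
    have h3 : ((Module.finrank (ResidueField (Localization.AtPrime 𝔪)) (CotangentSpace (Localization.AtPrime 𝔪)) : ℕ) :
        WithBot ℕ∞) ≤ (3 : ℕ) := h2 ▸ hdim𝔪
    have h4 : Module.finrank (ResidueField (Localization.AtPrime 𝔪)) (CotangentSpace (Localization.AtPrime 𝔪)) ≤ 3 := by
      exact_mod_cast h3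
    exact h1.trans h4
  -- the homogeneous element `h₀ ∉ 𝔪` with `F/1 ≠ 0` on `D(h₀)`
  haveI : IsDomain (Localization.AtPrime 𝔪) := isDomain_of_isRegularLocalRing (Localization.AtPrime 𝔪)
  obtain ⟨h₁, hh₁𝔪, hh₁⟩ := exists_not_mem_forall_algebraMap_ne_zero 𝔪 hF0
  set Bad : Set (Ideal A) := {𝔮 | ∃ _ : 𝔮.IsPrime, ∃ s ∉ 𝔮, s * F = 0} with hBad_def
  have hBad : ∀ 𝔮 ∈ Bad, h₁ ∈ 𝔮 := by
    rintro 𝔮 ⟨h𝔮, s, hs, hsF⟩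
    by_contra hh
    exact hh₁ 𝔮 hh ((algebraMap_eq_zero_iff_exists 𝔮 (Localization.AtPrime 𝔮) F).mpr ⟨s, hs, hsF⟩)
  have hcore : ∀ 𝔮 ∈ Bad, (𝔮.homogeneousCore (S.atlas.piece a)).toIdeal ∈ Bad := by
    rintro 𝔮 ⟨h𝔮, s, hs, hsF⟩
    exact ⟨E2Model.isPrime_homogeneousCore (S.atlas.piece a) h𝔮, s,
      fun h => hs (Ideal.toIdeal_homogeneousCore_le _ _ h), hsF⟩
  obtain ⟨d₀, hh₀𝔪, hh₀Bad⟩ := E2Model.exists_decompose_not_mem_forall_mem (S.atlas.piece a) hhom hh₁𝔪 Bad hBad hcore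
  set h₀ : A := (DirectSum.decompose (S.atlas.piece a) h₁ d₀ : A) with hh₀
  have hh₀deg : h₀ ∈ S.atlas.piece a d₀ := SetLike.coe_mem _
  have hNZ : ∀ (𝔮 : Ideal A) [𝔮.IsPrime], h₀ ∉ 𝔮 → algebraMap A (Localization.AtPrime 𝔮) F ≠ 0 := by
    intro 𝔮 _ hh₀𝔮 hF𝔮
    obtain ⟨s, hs, hsF⟩ := (algebraMap_eq_zero_iff_exists 𝔮 (Localization.AtPrime 𝔮) F).mp hF𝔮
    exact hh₀𝔮 (hh₀Bad 𝔮 ⟨inferInstance, s, hs, hsF⟩)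
  -- the section `t := h · g' · h₀`
  set t : A := h * g' * h₀ with ht
  have htdeg : t ∈ S.atlas.piece a (dh + dg' + d₀) := SetLike.mul_mem_graded (SetLike.mul_mem_graded hhdeg hg') hh₀deg
  have ht𝔪 : t ∉ 𝔪 := by
    intro hmem
    rcases h𝔪p.mem_or_mem hmem with h1 | h1
    · rcases h𝔪p.mem_or_mem h1 with h2 | h2
      · exact hh𝔪 h2
      · exact hg'𝔪 h2
    · exact hh₀𝔪 h1
  -- reading `t ∉ 𝔮` componentwise
  have hsplit : ∀ (𝔮 : Ideal A) [𝔮.IsPrime], t ∉ 𝔮 → h ∉ 𝔮 ∧ g' ∉ 𝔮 ∧ h₀ ∉ 𝔮 := fun 𝔮 _ htq =>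
    ⟨fun hh => htq (𝔮.mul_mem_right _ (𝔮.mul_mem_right _ hh)),
      fun hg => htq (𝔮.mul_mem_right _ (𝔮.mul_mem_left _ hg)), fun hh0 => htq (𝔮.mul_mem_left _ hh0)⟩
  -- points of `D(t)`: membership in `W a` and the prime of the point
  have hWa : ∀ {y : S.Y}, y ∈ S.Y.basicOpen t → y ∈ (S.atlas.W a : S.Y.Opens) := fun hy => S.Y.basicOpen_le t hy
  have htq : ∀ {y : S.Y} (hy : y ∈ S.Y.basicOpen t), t ∉ ((S.atlas.W a).2.primeIdealOf ⟨y, hWa hy⟩).asIdeal := fun hy =>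
    (mem_basicOpen_iff_not_mem (S.atlas.W a) (hWa hy) t).mp hy
  refine ⟨dh + dg' + d₀, t, N, U, w, htdeg, ht𝔪, hN, hw, hUhom, ?_, ?_, ?_⟩
  · -- (S5) the `J`-reading
    intro y hy hdim hUy m
    haveI : IsRegularLocalRing (S.Y.presheaf.stalk y) := S.isRegularLocalRing_stalk y
    set 𝔮 : Ideal A := ((S.atlas.W a).2.primeIdealOf ⟨y, hWa hy⟩).asIdeal with h𝔮
    haveI h𝔮p : 𝔮.IsPrime := ((S.atlas.W a).2.primeIdealOf ⟨y, hWa hy⟩).2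
    obtain ⟨hhq, hg'q, -⟩ := hsplit 𝔮 (htq hy)
    have hdimq : ringKrullDim (Localization.AtPrime 𝔮) ≤ (3 : ℕ) := by
      rw [ringKrullDim_eq_of_ringEquiv (stalkEquiv (S.atlas.W a) (hWa hy))]; exact hdim
    have hUq : ∀ i, U i ∈ 𝔮 := fun i => (germ_mem_maximalIdeal_iff_mem (S.atlas.W a) (hWa hy) (U i)).mp (hUy i)
    have hspan : stalkIdeal S.i.ker y = Ideal.span {(S.Y.presheaf.germ (S.atlas.W a) y (hWa hy)).hom F} :=
      S.stalkIdeal_eq_span_germ_of_not_mem (S.atlas.W a) hFI hg'F (hWa hy) hg'q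
    exact J_localGenerator_eq_map_germ_of_span hJiso hJu (S.atlas.W a) (hWa hy) hspan (((hcl 𝔮 hhq hdimq).2 hUq) m)
  · -- (S6) the zero reading
    intro y hy hdim
    haveI : IsRegularLocalRing (S.Y.presheaf.stalk y) := S.isRegularLocalRing_stalk y
    set 𝔮 : Ideal A := ((S.atlas.W a).2.primeIdealOf ⟨y, hWa hy⟩).asIdeal with h𝔮
    haveI h𝔮p : 𝔮.IsPrime := ((S.atlas.W a).2.primeIdealOf ⟨y, hWa hy⟩).2
    obtain ⟨hhq, hg'q, hh₀q⟩ := hsplit 𝔮 (htq hy)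
    have hdimq : ringKrullDim (Localization.AtPrime 𝔮) ≤ (3 : ℕ) := by
      rw [ringKrullDim_eq_of_ringEquiv (stalkEquiv (S.atlas.W a) (hWa hy))]; exact hdim
    have hspan : stalkIdeal S.i.ker y = Ideal.span {(S.Y.presheaf.germ (S.atlas.W a) y (hWa hy)).hom F} :=
      S.stalkIdeal_eq_span_germ_of_not_mem (S.atlas.W a) hFI hg'F (hWa hy) hg'q
    have hgerm0 : (S.Y.presheaf.germ (S.atlas.W a) y (hWa hy)).hom F ≠ 0 := fun h0 =>
      hNZ 𝔮 hh₀q ((algebraMap_eq_zero_iff_germ_eq_zero (S.atlas.W a) (hWa hy) F).mpr h0)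
    have hiff := (hcl 𝔮 hhq hdimq).1
    constructor
    · intro hUy
      have hUq : ∀ i, U i ∈ 𝔮 := fun i => (germ_mem_maximalIdeal_iff_mem (S.atlas.W a) (hWa hy) (U i)).mp (hUy i)
      obtain ⟨hF2q, hιq⟩ := hiff.mp hUq
      refine ⟨?_, ?_⟩
      · rw [mem_singImage_iff_mem_sq_of_stalkIdeal_eq S.i.ker hspan hgerm0,
          ← algebraMap_mem_maximalIdeal_pow_iff_germ_mem (S.atlas.W a) (hWa hy) F 2]
        exact hF2q
      · rw [iotaAt_eq_iota_of_span hc6 hu (S.atlas.W a) (hWa hy) hspan, hιq, hι𝔪]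
    · rintro ⟨hysing, hιy⟩
      have hF2q : algebraMap A (Localization.AtPrime 𝔮) F ∈ maximalIdeal (Localization.AtPrime 𝔮) ^ 2 := by
        rw [algebraMap_mem_maximalIdeal_pow_iff_germ_mem (S.atlas.W a) (hWa hy) F 2]
        exact (mem_singImage_iff_mem_sq_of_stalkIdeal_eq S.i.ker hspan hgerm0).mp hysing
      have hιq : ι (Localization.AtPrime 𝔮) (algebraMap A (Localization.AtPrime 𝔮) F) =
          ι (Localization.AtPrime 𝔪) (algebraMap A (Localization.AtPrime 𝔪) F) := by
        rw [← iotaAt_eq_iota_of_span hc6 hu (S.atlas.W a) (hWa hy) hspan, hιy, hι𝔪]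
      have hUq : ∀ i, U i ∈ 𝔮 := hiff.mpr ⟨hF2q, hιq⟩
      exact fun i => (germ_mem_maximalIdeal_iff_mem (S.atlas.W a) (hWa hy) (U i)).mpr (hUq i)
  · -- (S3) cotangent-independence at common zeros, transported along `A_𝔮 ≅ 𝒪_{Y,y}`
    intro y hy hUy
    set 𝔮 : Ideal A := ((S.atlas.W a).2.primeIdealOf ⟨y, hWa hy⟩).asIdeal with h𝔮
    haveI h𝔮p : 𝔮.IsPrime := ((S.atlas.W a).2.primeIdealOf ⟨y, hWa hy⟩).2
    obtain ⟨hhq, -, -⟩ := hsplit 𝔮 (htq hy)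
    have hUq : ∀ i, U i ∈ 𝔮 := fun i => (germ_mem_maximalIdeal_iff_mem (S.atlas.W a) (hWa hy) (U i)).mp (hUy i)
    obtain ⟨hU𝔮, hli⟩ := hregq 𝔮 hhq hUq
    have hex : ∀ i, stalkEquiv (S.atlas.W a) (hWa hy) (algebraMap A (Localization.AtPrime 𝔮) (U i)) ∈
        maximalIdeal (S.Y.presheaf.stalk y) := fun i => by
      rw [stalkEquiv_algebraMap]; exact hUy i
    have key := linearIndependent_toCotangent_map_ringEquiv (stalkEquiv (S.atlas.W a) (hWa hy))
      (fun i => algebraMap A (Localization.AtPrime 𝔮) (U i)) hU𝔮 hli hex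
    exact linearIndependent_toCotangent_congr hex hUy (fun i => stalkEquiv_algebraMap (S.atlas.W a) (hWa hy) (U i)) key

end Summit.ResolutionOfSingularities.ResolutionOfSingularities.Theorems.ELadderOne.Stage

end
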